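import Mathlib
import Summits.ResolutionOfSingularities.ResolutionOfSingularities.Theorems.WeightedInvariantLocalWeightedDropTOT2BudgetBasics

/-!
# TOT2-LINE (P3) brick B6-pairs: `branchVal` on ONE-DIMENSIONAL primes (no squarefreeness) and the TRANSPORT OF PAIR TERMS along a chart

Sub-problem `ResolutionOfSingularities`, ENGINE crux `stmt-ResolutionOfSingularities-8899` (`LocalWeightedDrop`), skeleton v35 (2e806da509994632),
registered stub `stub_conflictBudget` (P3); plan `L/res-L1-w43-stub-2/g6/B6-PLAN.md` §1 (iii)/(v).  [OURS · L1 W4.3 · chain w43 · res-L1-w43-stub-2 g6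
(owner of (P3)); def-free; nothing here is a statement of any manuscript; AI-produced, gate-checked, weaker than expert review.]

* §1 `branchVal_eq_addVal_of_dim` and the `_of_dim` API (`eq_top_iff`, `mul`, `one_le_X`, …) — `branchVal` on ANY one-dimensional prime (the
  index set `topPrimesD` of B0′ upstairs, where no squarefreeness is available);
* §2 `exists_mul_of_constantCoeff_eq_zero_chartOne/Two/translated` — a plane series vanishing at the origin becomes divisible by the exceptional
  variable under the plane point charts `(u₁,u₁u₂)`, `(u₁u₂,u₂)`, `(u₁, u₁(u₂+c))`;
* §3 **`pairVal_add_le_of_transport`** — along a ring map `Φ` with `Φ ∘ toThree = toThree ∘ φ₂`, `v_P = v_{P′} ∘ Φ` (B3), `P = Φ⁻¹P′`, `Q = Φ⁻¹Q′`,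
  and `toThree (φ₂ g) = u · toThree ĝ` for plane `g` vanishing at `0` with `u ∉ Q′`: `pairVal P′ Q′ + v_{P′}(u) ≤ pairVal P Q` — the pair terms of
  surviving branches drop by at least the value of the exceptional variable (point charts), resp. do not increase (`u = 1`, curve charts).
-/

set_option linter.dupNamespace false -- mandated namespace of this single-conjunct summit

noncomputable section

namespace Summit.ResolutionOfSingularities.ResolutionOfSingularities.Theorems

namespace TOT2Branch

open MvPowerSeries IsLocalRing Literature.AlgebraicGeometry.Resolution

variable {k : Type} [Field k]

/-! ## §1 `branchVal` on one-dimensional primes -/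

section Dim

variable {P : Ideal (MvPowerSeries (Fin 3) k)} [hP : P.IsPrime]

/-- `branchVal` unfolded on a one-dimensional prime. -/
theorem branchVal_eq_addVal_of_dim (hdim : ringKrullDim (MvPowerSeries (Fin 3) k ⧸ P) = 1) (f : MvPowerSeries (Fin 3) k) :
    branchVal P f =
      haveI := isDiscreteValuationRing_integralClosure P hdim
      IsDiscreteValuationRing.addVal (integralClosure (MvPowerSeries (Fin 3) k ⧸ P) (FractionRing (MvPowerSeries (Fin 3) k ⧸ P)))
        (algebraMap (MvPowerSeries (Fin 3) k ⧸ P) _ (Ideal.Quotient.mk P f)) :=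
  branchVal_eq (isDiscreteValuationRing_integralClosure P hdim) f

/-- `branchVal P f = ⊤ ↔ f ∈ P` on a one-dimensional prime. -/
theorem branchVal_eq_top_iff_of_dim (hdim : ringKrullDim (MvPowerSeries (Fin 3) k ⧸ P) = 1) (f : MvPowerSeries (Fin 3) k) :
    branchVal P f = ⊤ ↔ f ∈ P := by
  rw [branchVal_eq_addVal_of_dim hdim]; exact addVal_mk_eq_top_iff P hdim f

/-- Additivity on a one-dimensional prime. -/
theorem branchVal_mul_of_dim (hdim : ringKrullDim (MvPowerSeries (Fin 3) k ⧸ P) = 1) (f g : MvPowerSeries (Fin 3) k) :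
    branchVal P (f * g) = branchVal P f + branchVal P g := by
  rw [branchVal_eq_addVal_of_dim hdim, branchVal_eq_addVal_of_dim hdim, branchVal_eq_addVal_of_dim hdim]; exact addVal_mk_mul P hdim f g

/-- `branchVal P f = 0 ↔` unit, on a one-dimensional prime. -/
theorem branchVal_eq_zero_iff_of_dim (hdim : ringKrullDim (MvPowerSeries (Fin 3) k ⧸ P) = 1) (f : MvPowerSeries (Fin 3) k) :
    branchVal P f = 0 ↔ IsUnit f := by
  rw [branchVal_eq_addVal_of_dim hdim]; exact addVal_mk_eq_zero_iff P hdim f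

/-- `1 ≤ branchVal P f ↔ f ∈ 𝔪`, on a one-dimensional prime. -/
theorem one_le_branchVal_iff_of_dim (hdim : ringKrullDim (MvPowerSeries (Fin 3) k ⧸ P) = 1) (f : MvPowerSeries (Fin 3) k) :
    1 ≤ branchVal P f ↔ f ∈ maximalIdeal (MvPowerSeries (Fin 3) k) := by
  rw [branchVal_eq_addVal_of_dim hdim]; exact one_le_addVal_mk_iff P hdim f

/-- The variables have value `≥ 1` on a one-dimensional prime. -/
theorem one_le_branchVal_X_of_dim (hdim : ringKrullDim (MvPowerSeries (Fin 3) k ⧸ P) = 1) (i : Fin 3) : 1 ≤ branchVal P (X i) :=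
  (one_le_branchVal_iff_of_dim hdim (X i)).mpr (X_mem_maximalIdeal k (Fin 3) i)

end Dim

/-! ## §2 Plane series vanishing at the origin under the plane point charts -/

/-- A plane series with zero constant term is a combination of the two variables. -/
theorem exists_eq_add_of_constantCoeff_eq_zero {g : MvPowerSeries (Fin 2) k} (h0 : constantCoeff g = 0) :
    ∃ a b : MvPowerSeries (Fin 2) k, g = a * X 0 + b * X 1 := by
  have hg : g ∈ maximalIdeal (MvPowerSeries (Fin 2) k) := by
    rw [IsLocalRing.mem_maximalIdeal, mem_nonunits_iff, MvPowerSeries.isUnit_iff_constantCoeff, h0]; exact not_isUnit_zero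
  rw [maximalIdeal_mvPowerSeries_eq_span k (Fin 2)] at hg
  have hrange : Set.range (X : Fin 2 → MvPowerSeries (Fin 2) k) = {X 0, X 1} := by
    ext f; constructor
    · rintro ⟨i, rfl⟩; fin_cases i <;> simp
    · rintro (rfl | rfl) <;> exact ⟨_, rfl⟩
  rw [hrange] at hg
  obtain ⟨a, b, hab⟩ := Ideal.mem_span_pair.mp hg
  exact ⟨a, b, hab.symm⟩

/-- Under a substitution `φ` with `φ(u₁) = u · α`, `φ(u₂) = u · β`, a plane series vanishing at `0` becomes `u ·` something. -/
theorem exists_subst_eq_mul {τ : Type} (φ : Fin 2 → MvPowerSeries τ k) (hφ : HasSubst φ) (u α β : MvPowerSeries τ k)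
    (h0' : φ 0 = u * α) (h1' : φ 1 = u * β) {g : MvPowerSeries (Fin 2) k} (h0 : constantCoeff g = 0) :
    ∃ ĝ : MvPowerSeries τ k, subst φ g = u * ĝ := by
  obtain ⟨a, b, rfl⟩ := exists_eq_add_of_constantCoeff_eq_zero h0
  refine ⟨subst φ a * α + subst φ b * β, ?_⟩
  rw [← coe_substAlgHom hφ, map_add, map_mul, map_mul, coe_substAlgHom, subst_X hφ, subst_X hφ, h0', h1']
  ring

/-- `u₁`-chart: `g(u₁, u₁u₂) = u₁ · ĝ` for `g(0) = 0`. -/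
theorem exists_chartOne_eq_mul {g : MvPowerSeries (Fin 2) k} (h0 : constantCoeff g = 0) :
    ∃ ĝ : MvPowerSeries (Fin 2) k, subst (![X 0, X 0 * X 1] : Fin 2 → MvPowerSeries (Fin 2) k) g = X 0 * ĝ :=
  exists_subst_eq_mul _ (hasSubst_of_constantCoeff_zero fun i => by fin_cases i <;> simp) (X 0) 1 (X 1) (by simp) (by simp) h0

/-- `u₂`-chart: `g(u₁u₂, u₂) = u₂ · ĝ` for `g(0) = 0`. -/
theorem exists_chartTwo_eq_mul {g : MvPowerSeries (Fin 2) k} (h0 : constantCoeff g = 0) :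
    ∃ ĝ : MvPowerSeries (Fin 2) k, subst (![X 0 * X 1, X 1] : Fin 2 → MvPowerSeries (Fin 2) k) g = X 1 * ĝ :=
  exists_subst_eq_mul _ (hasSubst_of_constantCoeff_zero fun i => by fin_cases i <;> simp) (X 1) (X 0) 1 (by simp [mul_comm]) (by simp) h0

/-- Translated `u₁`-chart: `g(u₁, u₁(u₂ + c)) = u₁ · ĝ` for `g(0) = 0`. -/
theorem exists_chartTranslated_eq_mul (c : k) {g : MvPowerSeries (Fin 2) k} (h0 : constantCoeff g = 0) :
    ∃ ĝ : MvPowerSeries (Fin 2) k, subst (![X 0, X 0 * (X 1 + C c)] : Fin 2 → MvPowerSeries (Fin 2) k) g = X 0 * ĝ :=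
  exists_subst_eq_mul _ (hasSubst_of_constantCoeff_zero fun i => by fin_cases i <;> simp) (X 0) 1 (X 1 + C c) (by simp) (by simp) h0

/-! ## §3 Transport of pair terms along a chart -/

/-- The embedding preserves constant terms. -/
theorem constantCoeff_toThree (g : MvPowerSeries (Fin 2) k) : constantCoeff (toThree g) = constantCoeff g := by
  rw [toThree]; exact constantCoeff_rename _ g

/-- **TRANSPORT OF PAIR TERMS.**  Let `Φ` be a ring endomorphism of `k⟦u₁,u₂,y⟧` with `Φ (toThree g) = toThree (φ₂ g)` on plane series,
`P = Φ⁻¹P′`, `Q = Φ⁻¹Q′`, `v_P = v_{P′} ∘ Φ` (B3), and suppose every plane series vanishing at `0` satisfies `toThree (φ₂ g) = u · toThree ĝ` for some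
`ĝ`, where `u ∉ Q′`.  Then `pairVal P′ Q′ + v_{P′}(u) ≤ pairVal P Q` (for `P′` one-dimensional). -/
theorem pairVal_add_le_of_transport (Φ : MvPowerSeries (Fin 3) k →+* MvPowerSeries (Fin 3) k) (φ₂ : MvPowerSeries (Fin 2) k → MvPowerSeries (Fin 2) k)
    (hΦ : ∀ g, Φ (toThree g) = toThree (φ₂ g)) {P P' Q Q' : Ideal (MvPowerSeries (Fin 3) k)} [P'.IsPrime] [Q'.IsPrime]
    (hdim' : ringKrullDim (MvPowerSeries (Fin 3) k ⧸ P') = 1) (hPc : P = P'.comap Φ) (hQc : Q = Q'.comap Φ)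
    (hval : ∀ f, branchVal P f = branchVal P' (Φ f)) (u : MvPowerSeries (Fin 3) k) (huQ : u ∉ Q')
    (hu : ∀ g : MvPowerSeries (Fin 2) k, constantCoeff g = 0 → ∃ ĝ : MvPowerSeries (Fin 2) k, toThree (φ₂ g) = u * toThree ĝ) :
    pairVal P' Q' + branchVal P' u ≤ pairVal P Q := by
  rw [pairVal, pairVal]
  refine le_iInf fun g => ?_
  obtain ⟨g, hgQ, hgP⟩ := g
  -- `g(0) = 0` since `toThree g ∈ Q ⊆ 𝔪` (Q ≠ ⊤ as `Q'` is proper)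
  have hQ : Q ≠ ⊤ := by
    rw [hQc]; exact Ideal.comap_ne_top Φ (Ideal.IsPrime.ne_top ‹_›)
  have hg0 : constantCoeff g = 0 := by
    by_contra hne
    have hunit : IsUnit (toThree g) := by
      rw [MvPowerSeries.isUnit_iff_constantCoeff, constantCoeff_toThree]; exact isUnit_iff_ne_zero.mpr hne
    exact hQ (Ideal.eq_top_of_isUnit_mem Q hgQ hunit)
  obtain ⟨ĝ, hĝ⟩ := hu g hg0
  have hΦg : Φ (toThree g) = u * toThree ĝ := by rw [hΦ, hĝ]
  -- `toThree ĝ ∈ Q' ∖ P'`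
  have hĝQ : toThree ĝ ∈ Q' := by
    have h1 : Φ (toThree g) ∈ Q' := by rw [hQc] at hgQ; exact hgQ
    rw [hΦg] at h1
    exact ((‹Q'.IsPrime›).mem_or_mem h1).resolve_left huQ
  have hĝP : toThree ĝ ∉ P' := by
    intro h1
    apply hgP
    rw [hPc, Ideal.mem_comap, hΦg]
    exact Ideal.mul_mem_left _ _ h1
  calc (⨅ g' : {g' : MvPowerSeries (Fin 2) k // toThree g' ∈ Q' ∧ toThree g' ∉ P'}, branchVal P' (toThree g'.1)) + branchVal P' u
      ≤ branchVal P' (toThree ĝ) + branchVal P' u := by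
        gcongr
        exact iInf_le (fun g' : {g' : MvPowerSeries (Fin 2) k // toThree g' ∈ Q' ∧ toThree g' ∉ P'} => branchVal P' (toThree g'.1)) ⟨ĝ, hĝQ, hĝP⟩
    _ = branchVal P' (u * toThree ĝ) := by rw [branchVal_mul_of_dim hdim', add_comm]
    _ = branchVal P (toThree g) := by rw [hval, hΦg]

end TOT2Branch

end Summit.ResolutionOfSingularities.ResolutionOfSingularities.Theorems

end
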